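import Literature.Analysis.FluidPDE.SereginSverakTypeIConsequences
import Literature.Analysis.FluidPDE.SereginSverakPressureProofs
import Literature.Analysis.FluidPDE.Seregin2020ScaledEnergyBoundsA
import Literature.Analysis.FluidPDE.CKNTenThirdsInterpolation
import HarnessLib

/-!
# One-sided pressure bounds: scale-invariant bounds for `∬ |u|^{10/3}` and `∬ |q|^{3/2}` on the
# backward cylinders with vertex at a point of the final slice

Analysis/FluidPDE proof file (theorems only; no definitions, no named facts) on the discharge
path of the named fact `Literature.Analysis.FluidPDE.seregin_sverak_2002`
(`SereginSverakPressure.lean`; G. Seregin, V. Šverák, Arch. Ration. Mech. Anal. **163** (2002)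
65–86). For a classical Leray–Hopf solution on `[0, T)` (`ν = 1`) with `|u|²/2 + p̃ ≤ K` or
`p̃ ≥ -K` on `(0, T) × ℝ³`, a centre `x₀` and a radius `0 < ρ ≤ 1/2` with `ρ² < T`, it combines

* the Type I bound on the ball energies (`SereginSverak2002.setIntegral_ball_norm_sq_le_uniform`,
  i.e. `A(r; (T, x₀)) ≤ M` for `r ≤ ρ`),
* the gauged pair `(u, q)`, `q = p − (p(t, 0) − p̃[u(t)](0))`, which is a suitable weak solution
  on every cylinder inside `(0, T) × ℝ³` with `q ∈ L^{3/2}` there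
  (`isSuitableWeakSolutionOn_gauge_of_classical`, `lintegral_slab_gauged_pressure_lt_top`,
  `SereginSverakPressureProofs.lean`) and the Leray–Hopf weak gradient `G`,
* Seregin's theorem "bounded `A` ⇒ bounded `A + E + C + D`" on `]0, ρ/2]`
  (`Seregin2020.scaledEnergies_bounded_of_cknAEss_le`),
* and the local Lebesgue interpolation `∬_{Q_r} |u|^{10/3} ≤ K r^{5/3} A^{2/3} (A + E)`
  (`exists_lintegral_tenThirds_backward_le`),

into (`SereginSverak2002.exists_vertex_bounds`): there is `K₁ ≥ 0` (depending on the solution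
and the vertex) with, for all `0 < r ≤ ρ/2`,
`∬_{Q_r(T, x₀)} |u|^{10/3} ≤ K₁ r^{5/3}` and `∬_{Q_r(T, x₀)} |q|^{3/2} ≤ K₁ r²` — the
scale-invariant sizes which, through Hölder (`SereginSverakWindowHolder.lean`), make the window
flux of `SereginSverakProbeEnergyNoJump.lean` small on short parabolic windows.

## References

* G. Seregin, V. Šverák, Arch. Ration. Mech. Anal. 163 (2002), 65–86 (the result served).
  [SereginSverak2002]
* G. Seregin, Anal. Math. Phys. 10 (2020), Paper 46, remark after Def. 1.7. [Seregin2020]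
* P. G. Lemarié-Rieusset, *The Navier–Stokes Problem in the 21st Century* (2016), (13.18).
  [LemarieRieusset2016]
-/

noncomputable section

open _root_.MeasureTheory Set Function Filter _root_.Topology TopologicalSpace Metric Real
open scoped NNReal ENNReal RealInnerProductSpace ContDiff

namespace Literature.Analysis.FluidPDE

namespace SereginSverak2002

/-- **Type I for `A` at a vertex of the final slice, in the `ℝ≥0∞` vocabulary.** Under the
one-sided pressure bound, `A(r; (T, x₀)) ≤ 2(‖u(0)‖₂² + 4πK)` for `0 < r ≤ 1/2` with `r² ≤ T`.
[folklore] -/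
theorem cknAEss_le_uniform {T : ℝ}
    {u : ℝ → EuclideanSpace ℝ (Fin 3) → EuclideanSpace ℝ (Fin 3)}
    {p : ℝ → EuclideanSpace ℝ (Fin 3) → ℝ}
    (hsol : IsClassicalNSSolutionOn (Ico 0 T) 1 0 u p) (hLH : IsLerayHopfOn T 1 0 (u 0) u)
    {K : ℝ} (hK : 0 ≤ K)
    (hone : (∀ t ∈ Ioo 0 T, ∀ x, ‖u t x‖ ^ 2 / 2 + normalisedPressure (u t) x ≤ K) ∨
      (∀ t ∈ Ioo 0 T, ∀ x, -K ≤ normalisedPressure (u t) x))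
    (x₀ : EuclideanSpace ℝ (Fin 3)) {r : ℝ} (hr : 0 < r) (hr1 : r ≤ 1 / 2) (hrT : r ^ 2 ≤ T) :
    cknAEss r (T, x₀) u ≤ ENNReal.ofReal (2 * ((∫ x, ‖u 0 x‖ ^ 2) + 4 * π * K)) := by
  refine essSup_le_of_ae_le _ ((ae_restrict_iff' measurableSet_Ioo).2
    (Eventually.of_forall fun t ht => ?_))
  have ht0 : t ∈ Ioo 0 T := ⟨by simp only at ht; nlinarith [ht.1], ht.2⟩
  have hslice := setIntegral_ball_norm_sq_le_uniform zero_le_one hsol hLH hK hone ht0 x₀ hr hr1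
  have hL2 : Integrable fun x => ‖u t x‖ ^ 2 :=
    (hLH.memLp t ⟨ht0.1.le, ht0.2.le⟩).integrable_norm_pow two_ne_zero
  have hint : IntegrableOn (fun x => ‖u t x‖ ^ 2) (ball x₀ r) := hL2.integrableOn
  have hlin : ∫⁻ x in ball x₀ r, ‖u t x‖ₑ ^ 2 = ENNReal.ofReal (∫ x in ball x₀ r, ‖u t x‖ ^ 2) := by
    rw [ofReal_integral_eq_lintegral_ofReal hint (Eventually.of_forall fun x => by positivity)]
    refine lintegral_congr fun x => ?_
    rw [← ofReal_norm, ← ENNReal.ofReal_pow (norm_nonneg _)]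
  show (ENNReal.ofReal r)⁻¹ * ∫⁻ x in ball (T, x₀).2 r, ‖u t x‖ₑ ^ 2 ≤
    ENNReal.ofReal (2 * ((∫ x, ‖u 0 x‖ ^ 2) + 4 * π * K))
  rw [show (T, x₀).2 = x₀ from rfl, hlin, ← ENNReal.ofReal_inv_of_pos hr,
    ← ENNReal.ofReal_mul (inv_pos.2 hr).le]
  refine ENNReal.ofReal_le_ofReal ?_
  rw [inv_mul_le_iff₀ hr]
  linarith

/-- **Scale-invariant bounds for `∬ |u|^{10/3}` and `∬ |q|^{3/2}` on the backward cylinders with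
vertex `(T, x₀)`.** For a classical Leray–Hopf solution on `[0, T)` (`ν = 1`) with a one-sided
pressure bound (`K ≥ 0`), a centre `x₀` and `0 < ρ ≤ 1/2` with `ρ² < T`, there is `K₁` such that
for every `0 < r ≤ ρ/2`:
`∬_{Q_r(T,x₀)} |u|^{10/3} ≤ K₁ r^{5/3}` and `∬_{Q_r(T,x₀)} |q|^{3/2} ≤ K₁ r²` for the gauged
pressure `q = p − (p(t,0) − p̃[u(t)](0))`. [cite: SereginSverak2002, §3 (scaled energies at a singular point); Seregin2020 remark after Def. 1.7] -/
theorem exists_vertex_bounds {T : ℝ} (hT : 0 < T)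
    {u : ℝ → EuclideanSpace ℝ (Fin 3) → EuclideanSpace ℝ (Fin 3)}
    {p : ℝ → EuclideanSpace ℝ (Fin 3) → ℝ}
    (hsol : IsClassicalNSSolutionOn (Ico 0 T) 1 0 u p) (hLH : IsLerayHopfOn T 1 0 (u 0) u)
    {K : ℝ} (hK : 0 ≤ K)
    (hone : (∀ t ∈ Ioo 0 T, ∀ x, ‖u t x‖ ^ 2 / 2 + normalisedPressure (u t) x ≤ K) ∨
      (∀ t ∈ Ioo 0 T, ∀ x, -K ≤ normalisedPressure (u t) x))
    (x₀ : EuclideanSpace ℝ (Fin 3)) {ρ : ℝ} (hρ : 0 < ρ) (hρ1 : ρ ≤ 1 / 2) (hρT : ρ ^ 2 < T) :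
    ∃ K₁ : ℝ≥0, ∀ r ∈ Ioc 0 (ρ / 2),
      (∫⁻ z in parabolicCylinder r (T, x₀), ‖u z.1 z.2‖ₑ ^ (10 / 3 : ℝ) ≤
          K₁ * ENNReal.ofReal (r ^ (5 / 3 : ℝ))) ∧
      (∫⁻ z in parabolicCylinder r (T, x₀),
          ‖p z.1 z.2 - (p z.1 0 - normalisedPressure (u z.1) 0)‖ₑ ^ (3 / 2 : ℝ) ≤
          K₁ * ENNReal.ofReal (r ^ 2)) := by
  -- the cylinder `Q_ρ(T, x₀)` inside the open slab
  set z₀ : ℝ × EuclideanSpace ℝ (Fin 3) := (T, x₀) with hz₀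
  set Q : Opens (ℝ × EuclideanSpace ℝ (Fin 3)) := parabolicCylinderOpens ρ z₀ with hQdef
  have hQ : (Q : Set (ℝ × EuclideanSpace ℝ (Fin 3))) = parabolicCylinder ρ z₀ := rfl
  have hQslab : (Q : Set (ℝ × EuclideanSpace ℝ (Fin 3))) ⊆
      Ioo 0 T ×ˢ (univ : Set (EuclideanSpace ℝ (Fin 3))) := by
    rw [hQ, parabolicCylinder]
    rintro ⟨t, x⟩ ⟨⟨ht1, ht2⟩, -⟩
    exact ⟨⟨by simp only [hz₀] at ht1; linarith, ht2⟩, mem_univ _⟩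
  -- the gauged suitable weak solution on `Q`
  set q : ℝ → EuclideanSpace ℝ (Fin 3) → ℝ :=
    fun t x => p t x - (p t 0 - normalisedPressure (u t) 0) with hq
  have hsws : IsSuitableWeakSolutionOn Q 1 0 u q :=
    isSuitableWeakSolutionOn_gauge_of_classical one_pos hT hsol hLH Q hQslab
  -- the Leray–Hopf weak gradient
  obtain ⟨G, hGslab, -, hGint, -⟩ := hLH.exists_hasWeakSpatialGradientOn
  have hle : Q ≤ slab (EuclideanSpace ℝ (Fin 3)) (Ioo 0 T) isOpen_Ioo := by
    intro z hz
    change z ∈ Ioo 0 T ×ˢ (univ : Set (EuclideanSpace ℝ (Fin 3)))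
    exact hQslab hz
  have hG : HasWeakSpatialGradientOn Q u G := hGslab.mono hle
  -- finiteness of `E(ρ)` and `D(ρ)` at the vertex
  have hρ0 : ENNReal.ofReal ρ ≠ 0 := by rwa [ne_eq, ENNReal.ofReal_eq_zero, not_le]
  have hE₀ : cknE ρ z₀ G ≠ ⊤ := by
    refine ENNReal.mul_ne_top (ENNReal.inv_ne_top.2 hρ0) (ne_top_of_le_ne_top hGint.ne ?_)
    exact lintegral_mono_set (by rw [← hQ]; exact hQslab)
  have hD₀ : cknD ρ z₀ q ≠ ⊤ := by
    refine ENNReal.mul_ne_top (ENNReal.inv_ne_top.2 (pow_ne_zero 2 hρ0))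
      (ne_top_of_le_ne_top (lintegral_slab_gauged_pressure_lt_top one_pos hT hsol hLH).ne ?_)
    exact lintegral_mono_set (by rw [← hQ]; exact hQslab)
  -- Type I for `A` on `]0, ρ]`
  set M : ℝ≥0 := (2 * ((∫ x, ‖u 0 x‖ ^ 2) + 4 * π * K)).toNNReal with hM
  have hMA : ∀ r ∈ Ioc (0 : ℝ) ρ, cknAEss r z₀ u ≤ M := by
    intro r hr
    have h := cknAEss_le_uniform hsol hLH hK hone x₀ hr.1 (hr.2.trans hρ1)
      (by nlinarith [hr.1, hr.2, hρT])
    rw [hM, ENNReal.ofReal] at *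
    exact h
  -- Seregin: all scaled energies bounded on `]0, ρ/2]`
  obtain ⟨K₀, hK₀⟩ := Seregin2020.scaledEnergies_bounded_of_cknAEss_le hsws hG hρ
    (by rw [hQ]) hE₀ hD₀ hMA
  -- the `L^{10/3}` constant
  obtain ⟨K₁₀, hK₁₀⟩ := exists_lintegral_tenThirds_backward_le
  refine ⟨K₁₀ * K₀ ^ (2 / 3 : ℝ) * (2 * K₀) + K₀, fun r hr => ?_⟩
  have hr0 : 0 < r := hr.1
  have hrρ : r ≤ ρ := hr.2.trans (by linarith)
  have hsum := hK₀ r hr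
  have hA : cknAEss r z₀ u ≤ K₀ := le_trans (by
    calc cknAEss r z₀ u ≤ cknAEss r z₀ u + cknE r z₀ G + cknC r z₀ u + cknD r z₀ q :=
          le_add_right (le_add_right (le_add_right le_rfl))) hsum
  have hE : cknE r z₀ G ≤ K₀ := le_trans (by
    calc cknE r z₀ G ≤ cknAEss r z₀ u + cknE r z₀ G + cknC r z₀ u + cknD r z₀ q :=
          le_add_right (le_add_right le_add_self)) hsum
  have hD : cknD r z₀ q ≤ K₀ := le_trans le_add_self hsum
  have hAtop : cknAEss r z₀ u ≠ ⊤ := ne_top_of_le_ne_top ENNReal.coe_ne_top hA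
  have hEtop : cknE r z₀ G ≠ ⊤ := ne_top_of_le_ne_top ENNReal.coe_ne_top hE
  -- weak gradient on the smaller cylinder
  have hGr : HasWeakSpatialGradientOn (parabolicCylinderOpens r z₀) u G := by
    refine hG.mono fun z hz => ?_
    have hz' : z ∈ parabolicCylinder r z₀ := hz
    show z ∈ (Q : Set (ℝ × EuclideanSpace ℝ (Fin 3)))
    rw [hQ]
    -- `Q_r(z₀) ⊆ Q_ρ(z₀)` for `r ≤ ρ` (cf. `parabolicCylinder_subset_of_le` in `NSLerayHopfSereginMild`)
    rw [parabolicCylinder] at hz' ⊢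
    have h2 : r ^ 2 ≤ ρ ^ 2 := pow_le_pow_left₀ hr0.le hrρ 2
    exact prod_mono (Ioo_subset_Ioo (by linarith) le_rfl) (ball_subset_ball hrρ) hz'
  constructor
  · -- `∬ |u|^{10/3}`
    have h := hK₁₀ u G z₀ r hr0 hGr hAtop hEtop
    calc ∫⁻ z in parabolicCylinder r z₀, ‖u z.1 z.2‖ₑ ^ (10 / 3 : ℝ)
        ≤ K₁₀ * ENNReal.ofReal (r ^ (5 / 3 : ℝ)) * cknAEss r z₀ u ^ (2 / 3 : ℝ) *
            (cknAEss r z₀ u + cknE r z₀ G) := h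
      _ ≤ K₁₀ * ENNReal.ofReal (r ^ (5 / 3 : ℝ)) * (K₀ : ℝ≥0∞) ^ (2 / 3 : ℝ) * (K₀ + K₀) := by
          gcongr
      _ = ((K₁₀ * K₀ ^ (2 / 3 : ℝ) * (2 * K₀) : ℝ≥0) : ℝ≥0∞) * ENNReal.ofReal (r ^ (5 / 3 : ℝ)) := by
          rw [← two_mul]
          push_cast
          rw [ENNReal.coe_rpow_of_nonneg _ (by norm_num)]
          ring
      _ ≤ ((K₁₀ * K₀ ^ (2 / 3 : ℝ) * (2 * K₀) + K₀ : ℝ≥0) : ℝ≥0∞) *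
            ENNReal.ofReal (r ^ (5 / 3 : ℝ)) := by
          gcongr
          exact le_self_add
  · -- `∬ |q|^{3/2}`
    have hr2 : ENNReal.ofReal r ^ 2 ≠ 0 := pow_ne_zero 2 (by rwa [ne_eq, ENNReal.ofReal_eq_zero, not_le])
    have hr2' : ENNReal.ofReal r ^ 2 ≠ ⊤ := ENNReal.pow_ne_top ENNReal.ofReal_ne_top
    have hDdef : cknD r z₀ q = (ENNReal.ofReal r ^ 2)⁻¹ *
        ∫⁻ z in parabolicCylinder r z₀, ‖q z.1 z.2‖ₑ ^ (3 / 2 : ℝ) := rfl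
    have hX : ∫⁻ z in parabolicCylinder r z₀, ‖q z.1 z.2‖ₑ ^ (3 / 2 : ℝ) ≤
        ENNReal.ofReal r ^ 2 * K₀ := by
      have h1 : (ENNReal.ofReal r ^ 2)⁻¹ * ∫⁻ z in parabolicCylinder r z₀, ‖q z.1 z.2‖ₑ ^ (3 / 2 : ℝ) ≤
          K₀ := by rw [← hDdef]; exact hD
      calc ∫⁻ z in parabolicCylinder r z₀, ‖q z.1 z.2‖ₑ ^ (3 / 2 : ℝ)
          = ENNReal.ofReal r ^ 2 * ((ENNReal.ofReal r ^ 2)⁻¹ *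
              ∫⁻ z in parabolicCylinder r z₀, ‖q z.1 z.2‖ₑ ^ (3 / 2 : ℝ)) := by
            rw [← mul_assoc, ENNReal.mul_inv_cancel hr2 hr2', one_mul]
        _ ≤ ENNReal.ofReal r ^ 2 * K₀ := by gcongr
    calc ∫⁻ z in parabolicCylinder r z₀, ‖q z.1 z.2‖ₑ ^ (3 / 2 : ℝ)
        ≤ ENNReal.ofReal r ^ 2 * K₀ := hX
      _ = (K₀ : ℝ≥0∞) * ENNReal.ofReal (r ^ 2) := by
          rw [ENNReal.ofReal_pow hr0.le, mul_comm]
      _ ≤ ((K₁₀ * K₀ ^ (2 / 3 : ℝ) * (2 * K₀) + K₀ : ℝ≥0) : ℝ≥0∞) * ENNReal.ofReal (r ^ 2) := by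
          gcongr
          exact le_add_self

end SereginSverak2002

end Literature.Analysis.FluidPDE

end
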